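import Summits.AnomalousDissipation.AnomalousDissipation.Theorems.SawtoothPulseCascadeK1LocalisedCascadeAffinePair
import Summits.AnomalousDissipation.AnomalousDissipation.Theorems.SawtoothPulseCascadeK1LocalisedCascadeItinRow
import Summits.AnomalousDissipation.AnomalousDissipation.Theorems.SawtoothPulseCascadeK1LocalisedCascadeFlatComponents
import Summits.AnomalousDissipation.AnomalousDissipation.Theorems.SawtoothPulseCascadeK1LocalisedCascadePlanarLink

/-!
# K1loc, line `Spectral` — S-D (first good piece): A GOOD PIECE OF THE CHORD IS AFFINE (the analytic input of the line refinement)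

Helper file of the prover lane on the crux `K1LocalisedCascade` (stmt-AnomalousDissipation-19491), route
`SawtoothPulseCascade`, registered line `Cruxes.K1LocalisedCascade.Spectral` (one open stub `stub_highModeConcentration`).
Route (i) of memo v8 §8 refines the chord `s ↦ Y + s e₀` by `…K1Start.phase_cut`, whose hypotheses are AFFINE statements about the backward
trajectory `z_s` (`z_s n = Y + s e₀`, `z_s j = S_{H,j}(S_{V,j}(z_s (j+1)))`).  This file derives them on a GOOD PIECE `[u, v]` at level `j₀`
(for every `s ∈ [u, v]` and every phase `j₀ ≤ j < n` the V-input `(z_s (j+1))₀` and the H-input `(z_s (j+1))₁ − γU_j((z_s (j+1))₀)` lie in the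
`M₂`-flat components of ranks `pV j`, `pH j`; rank `p` ↔ `(k, σ) = (p / 2, 1 − 2(p % 2))`, `…FlatComponents`):

* `rank_component_eq` — the rank-`p` component is the `(k, σ)` component of `…FlatComponents` (`k − σ/4 = p/2 − 1/4`);
* `norm_traj_sub_sub_itinJac_le` — `‖z_{s′}(j₀) − z_s(j₀) − itinJac γ L ((s′ − s)e₀)‖_∞ ≤ Err`, `L` the piece's itinerary
  (`…AffinePair.norm_sub_sub_itinJac_mulVec_le_of_lt` on the reindexed trajectory, `…PlanarLink.trajectory_coords`, flat affinity from
  `…FlatComponents.abs_U_sub_U_sub_sign_le_of_mem_component`), `Err = Σ_{i<n−j₀} (1+γ+γ²)^i (γ² + γ)(1/(2N_{j₀+i}) − 2ζ_{j₀+i}) η`, `η = 2e^{−M₂²/2}`;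
* `abs_cV_affine`, `abs_cH_affine` — the V-coordinate `(z_s j₀)₀` is affine with slope `λ_V = (itinJac γ L)₀₀` up to `Err`, and on a sub-interval
  where it stays in the component `p` of stage `j₀ − 1` the H-coordinate `(z_s j₀)₁ − γU_{j₀−1}((z_s j₀)₀)` is affine with slope
  `λ_H = (itinJac γ L)₁₀ − γσ_p(itinJac γ L)₀₀` up to `(1+γ)Err + γη(|λ_V|(b − a) + Err)`;
* `slopes_piece` — `|λ_V| ≥ (γ²−3)^{n−j₀} > 0`, `(γ − 2/γ)|λ_V| ≤ |λ_H| ≤ (γ + 2/γ)|λ_V|` (`…ItinRow`).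

WHAT THIS IS NOT: no refinement (that is `phase_cut` + the `Q`-recursion). [cite: ElgindiLissMattingly2025, §1.2.2, §3.1] [problem: turb]
-/

-- `Summit.<Summit>.<Problem>`: single-conjunct summit, the duplicate namespace segment is deliberate.
set_option linter.dupNamespace false

noncomputable section

namespace Summit.AnomalousDissipation.AnomalousDissipation.Theorems.SawtoothPulseCascade.K1Start

open Set Matrix Function UnitAddTorus
open Literature.Analysis Literature.Analysis.FunctionSpaces Literature.Analysis.FunctionSpaces.Torus
open Literature.Analysis.FluidPDE.ShearStage
open Literature.Analysis.FluidPDE.SawtoothCascade Literature.Analysis.FluidPDE.SawtoothCascade.CascadeParams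

/-! ## §1 Rank `p` ↔ `(k, σ)` -/

/-- The sign of rank `p`: `σ_p = 1 − 2(p % 2) ∈ {1, −1}`. [folklore] -/
theorem rankSign_eq_or (p : ℤ) : (1 - 2 * ((p % 2 : ℤ) : ℝ) = 1) ∨ (1 - 2 * ((p % 2 : ℤ) : ℝ) = -1) := by
  rcases Int.emod_two_eq_zero_or_one p with h | h <;> rw [h] <;> norm_num

/-- The rank-`p` component is the `(k, σ)` component of `…FlatComponents` with `k = p / 2`, `σ = 1 − 2(p % 2)`:
`k − σ/4 = p/2 − 1/4`. [folklore] -/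
theorem rank_component_eq (p : ℤ) : ((p / 2 : ℤ) : ℝ) - (1 - 2 * ((p % 2 : ℤ) : ℝ)) / 4 = (p : ℝ) / 2 - 1 / 4 := by
  have h := Int.mul_ediv_add_emod p 2
  have h' : (p : ℝ) = 2 * ((p / 2 : ℤ) : ℝ) + ((p % 2 : ℤ) : ℝ) := by
    have := congrArg (fun z : ℤ => (z : ℝ)) h
    push_cast at this
    linarith
  rw [h']; ring

section Piece

variable (P : CascadeParams)

/-- **Flat affinity on a rank-`p` component** (`…FlatComponents.abs_U_sub_U_sub_sign_le_of_mem_component` re-indexed by rank).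
[cite: ElgindiLissMattingly2025, §1 (slope ±1 branches)] -/
theorem abs_U_sub_U_sub_rankSign_le (hδ₀ : 0 < P.δ₀) (hd : 0 < P.d) (hN₀ : 1 ≤ P.N₀) (hρ : 1 ≤ P.ρN) {j : ℕ} {M : ℝ}
    (hM : 1 ≤ M) (hMδ : M * P.δ j < Real.pi / 2) (p : ℤ) {y y' : ℝ}
    (hy : y ∈ Icc (((p : ℝ) / 2 - 1 / 4) / P.N j + M * P.δ j / (2 * Real.pi * P.N j))
      (((p : ℝ) / 2 + 1 / 4) / P.N j - M * P.δ j / (2 * Real.pi * P.N j)))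
    (hy' : y' ∈ Icc (((p : ℝ) / 2 - 1 / 4) / P.N j + M * P.δ j / (2 * Real.pi * P.N j))
      (((p : ℝ) / 2 + 1 / 4) / P.N j - M * P.δ j / (2 * Real.pi * P.N j))) :
    |P.U j y - P.U j y' - (1 - 2 * ((p % 2 : ℤ) : ℝ)) * (y - y')| ≤ 2 * Real.exp (-(M ^ 2 / 2)) * |y - y'| := by
  have e := rank_component_eq p
  have e3 : (p : ℝ) / 2 - 1 / 4 + 1 / 2 = (p : ℝ) / 2 + 1 / 4 := by ring
  refine abs_U_sub_U_sub_sign_le_of_mem_component P hδ₀ hd hN₀ hρ hM hMδ (p / 2) (rankSign_eq_or p) ?_ ?_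
  · rw [e, e3]; exact hy
  · rw [e, e3]; exact hy'

/-- **A good piece is affine (planar form).**  Let `z : ℝ → ℕ → ℝ²` be the backward trajectories of the chord (`z s n = Y + s e₀`,
`z s j = S_{H,j}(S_{V,j}(z s (j+1)))` for `j < n`), `j₀ ≤ n`, and `[u, v]` a GOOD PIECE at level `j₀` with ranks `pV, pH` (V- and H-inputs of
every phase `j₀ ≤ j < n` in the `M₂`-components of those ranks, `M₂ ≥ 1`, `M₂δ_j < π/2`, `γ ≥ 1`).  Then for `s, s′ ∈ [u, v]`:
`‖z_{s′}(j₀) − z_s(j₀) − itinJac γ L ((s′ − s)e₀)‖_∞ ≤ Err`, with `L = [(−σ_{pH(j₀+i)}, −σ_{pV(j₀+i)})]_{i < n−j₀}` and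
`Err = Σ_{i<n−j₀} (1+γ+γ²)^i (γ²ℓ_{j₀+i} + γℓ_{j₀+i}) · 2e^{−M₂²/2}`, `ℓ_j = 1/(2N_j) − M₂δ_j/(πN_j)` the component length.
[cite: ElgindiLissMattingly2025, §1.2.2 (∇T^N = Π A_{j_i} off the corner strips)] -/
theorem norm_traj_sub_sub_itinJac_le (hγ : 1 ≤ P.γ) (hδ₀ : 0 < P.δ₀) (hd : 0 < P.d) (hN₀ : 1 ≤ P.N₀) (hρ : 1 ≤ P.ρN)
    {M₂ : ℝ} (hM : 1 ≤ M₂) (hMδ : ∀ j, M₂ * P.δ j < Real.pi / 2) {n j₀ : ℕ} (hj₀ : j₀ ≤ n) (Y : EuclideanSpace ℝ (Fin 2))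
    (z : ℝ → ℕ → EuclideanSpace ℝ (Fin 2)) (hzn : ∀ s, z s n = Y + s • EuclideanSpace.single 0 1)
    (hz : ∀ s, ∀ j < n, z s j = shearMapLift 0 1 (amp ⟨P.U j, P.U_periodic j, P.contDiff_U (P.δ_pos hδ₀ hd j)⟩ P.γ)
      (shearMapLift 1 0 (amp ⟨P.U j, P.U_periodic j, P.contDiff_U (P.δ_pos hδ₀ hd j)⟩ P.γ) (z s (j + 1))))
    {u v : ℝ} (pV pH : ℕ → ℤ)
    (hgood : ∀ s ∈ Icc u v, ∀ j, j₀ ≤ j → j < n →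
      (z s (j + 1)) 0 ∈ Icc (((pV j : ℝ) / 2 - 1 / 4) / P.N j + M₂ * P.δ j / (2 * Real.pi * P.N j))
        (((pV j : ℝ) / 2 + 1 / 4) / P.N j - M₂ * P.δ j / (2 * Real.pi * P.N j)) ∧
      (z s (j + 1)) 1 - P.γ * P.U j ((z s (j + 1)) 0) ∈ Icc (((pH j : ℝ) / 2 - 1 / 4) / P.N j + M₂ * P.δ j / (2 * Real.pi * P.N j))
        (((pH j : ℝ) / 2 + 1 / 4) / P.N j - M₂ * P.δ j / (2 * Real.pi * P.N j)))
    {s s' : ℝ} (hs : s ∈ Icc u v) (hs' : s' ∈ Icc u v) :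
    ‖(WithLp.ofLp (z s' j₀) - WithLp.ofLp (z s j₀)) -
        itinJac P.γ ((List.range (n - j₀)).map fun i =>
          (-(1 - 2 * ((pH (j₀ + i) % 2 : ℤ) : ℝ)), -(1 - 2 * ((pV (j₀ + i) % 2 : ℤ) : ℝ)))) *ᵥ
        ((s' - s) • (Pi.single 0 1 : Fin 2 → ℝ))‖ ≤
      ∑ i ∈ Finset.range (n - j₀), (1 + P.γ + P.γ ^ 2) ^ i *
        ((P.γ ^ 2 * (1 / (2 * P.N (j₀ + i)) - M₂ * P.δ (j₀ + i) / (Real.pi * P.N (j₀ + i))) +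
          P.γ * (1 / (2 * P.N (j₀ + i)) - M₂ * P.δ (j₀ + i) / (Real.pi * P.N (j₀ + i)))) * (2 * Real.exp (-(M₂ ^ 2 / 2)))) := by
  -- reindexed data: phase `i` of the piece is phase `j₀ + i` of the cascade
  set ℓ : ℕ := n - j₀ with hℓ
  have hnℓ : j₀ + ℓ = n := by rw [hℓ]; omega
  set U : ℕ → ℝ → ℝ := fun i => P.U (j₀ + i) with hU
  set σV : ℕ → ℝ := fun i => 1 - 2 * ((pV (j₀ + i) % 2 : ℤ) : ℝ) with hσV
  set σH : ℕ → ℝ := fun i => 1 - 2 * ((pH (j₀ + i) % 2 : ℤ) : ℝ) with hσH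
  set η : ℕ → ℝ := fun _ => 2 * Real.exp (-(M₂ ^ 2 / 2)) with hη
  set aV : ℕ → ℝ := fun i => ((pV (j₀ + i) : ℝ) / 2 - 1 / 4) / P.N (j₀ + i) + M₂ * P.δ (j₀ + i) / (2 * Real.pi * P.N (j₀ + i))
    with haV
  set bV : ℕ → ℝ := fun i => ((pV (j₀ + i) : ℝ) / 2 + 1 / 4) / P.N (j₀ + i) - M₂ * P.δ (j₀ + i) / (2 * Real.pi * P.N (j₀ + i))
    with hbV
  set aH : ℕ → ℝ := fun i => ((pH (j₀ + i) : ℝ) / 2 - 1 / 4) / P.N (j₀ + i) + M₂ * P.δ (j₀ + i) / (2 * Real.pi * P.N (j₀ + i))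
    with haH
  set bH : ℕ → ℝ := fun i => ((pH (j₀ + i) : ℝ) / 2 + 1 / 4) / P.N (j₀ + i) - M₂ * P.δ (j₀ + i) / (2 * Real.pi * P.N (j₀ + i))
    with hbH
  -- the two trajectories and their V-outputs, as `Fin 2 → ℝ`
  set Z : ℕ → Fin 2 → ℝ := fun i => WithLp.ofLp (z s (j₀ + i)) with hZ
  set Z' : ℕ → Fin 2 → ℝ := fun i => WithLp.ofLp (z s' (j₀ + i)) with hZ'
  set W : ℕ → Fin 2 → ℝ := fun i => ![Z (i + 1) 0, Z (i + 1) 1 - P.γ * U i (Z (i + 1) 0)] with hW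
  set W' : ℕ → Fin 2 → ℝ := fun i => ![Z' (i + 1) 0, Z' (i + 1) 1 - P.γ * U i (Z' (i + 1) 0)] with hW'
  -- flat affinity on the components
  have hUV : ∀ i, ∀ x ∈ Icc (aV i) (bV i), ∀ x' ∈ Icc (aV i) (bV i), |U i x - U i x' - σV i * (x - x')| ≤ η i * |x - x'| :=
    fun i x hx x' hx' => abs_U_sub_U_sub_rankSign_le P hδ₀ hd hN₀ hρ hM (hMδ _) (pV (j₀ + i)) hx hx'
  have hUH : ∀ i, ∀ x ∈ Icc (aH i) (bH i), ∀ x' ∈ Icc (aH i) (bH i), |U i x - U i x' - σH i * (x - x')| ≤ η i * |x - x'| :=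
    fun i x hx x' hx' => abs_U_sub_U_sub_rankSign_le P hδ₀ hd hN₀ hρ hM (hMδ _) (pH (j₀ + i)) hx hx'
  -- the recursion below level `ℓ` (coordinates of the trajectory)
  have hrec : ∀ (t : ℝ) (i : ℕ), i < ℓ →
      (WithLp.ofLp (z t (j₀ + i))) 0 = (z t (j₀ + i + 1)) 0 - P.γ * U i ((z t (j₀ + i + 1)) 1 - P.γ * U i ((z t (j₀ + i + 1)) 0)) ∧
      (WithLp.ofLp (z t (j₀ + i))) 1 = (z t (j₀ + i + 1)) 1 - P.γ * U i ((z t (j₀ + i + 1)) 0) := by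
    intro t i hi
    have hlt : j₀ + i < n := by omega
    have h := trajectory_coords P hδ₀ hd n (z t)
      (fun j => shearMapLift 1 0 (amp ⟨P.U j, P.U_periodic j, P.contDiff_U (P.δ_pos hδ₀ hd j)⟩ P.γ) (z t (j + 1)))
      (fun j _ => rfl) (fun j hj => hz t j hj) (j₀ + i) hlt
    obtain ⟨h0, h1, h2, h3⟩ := h
    exact ⟨by rw [h2, h0, h1], by rw [h3, h1]⟩
  have hmain := norm_sub_sub_itinJac_mulVec_le_of_lt U hγ σH σV η aV bV aH bH (fun _ => by positivity)
    (fun i => rankSign_eq_or _) (fun i => rankSign_eq_or _) hUV hUH ℓ Z Z' W W'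
    (fun i _ => by simp [hW]) (fun i _ => by simp [hW]) (fun i _ => by simp [hW']) (fun i _ => by simp [hW'])
    (fun i hi => by simp only [hZ, hW, cons_val_zero, cons_val_one]; exact (hrec s i hi).1)
    (fun i hi => by simp only [hZ, hW, cons_val_one]; exact (hrec s i hi).2)
    (fun i hi => by simp only [hZ', hW', cons_val_zero, cons_val_one]; exact (hrec s' i hi).1)
    (fun i hi => by simp only [hZ', hW', cons_val_one]; exact (hrec s' i hi).2)
    (fun i hi => ⟨(hgood s hs (j₀ + i) (by omega) (by omega)).1, (hgood s' hs' (j₀ + i) (by omega) (by omega)).1⟩)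
    (fun i hi => by
      simp only [hW, hW', cons_val_one]
      exact ⟨(hgood s hs (j₀ + i) (by omega) (by omega)).2, (hgood s' hs' (j₀ + i) (by omega) (by omega)).2⟩)
  -- identify the endpoints: `Z 0 = z s j₀`, `Z' ℓ − Z ℓ = (s' − s) e₀`
  have hend : Z' ℓ - Z ℓ = (s' - s) • (Pi.single 0 1 : Fin 2 → ℝ) := by
    simp only [hZ, hZ', hnℓ, hzn, ← WithLp.ofLp_sub]
    rw [show Y + s' • EuclideanSpace.single (0 : Fin 2) (1 : ℝ) - (Y + s • EuclideanSpace.single 0 1) =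
      (s' - s) • EuclideanSpace.single 0 1 by rw [sub_smul]; abel]
    rw [WithLp.ofLp_smul]
    rfl
  have h0 : Z' 0 - Z 0 = WithLp.ofLp (z s' j₀) - WithLp.ofLp (z s j₀) := by simp [hZ, hZ']
  rw [hend, h0] at hmain
  refine hmain.trans_eq (Finset.sum_congr rfl fun i _ => ?_)
  simp only [haV, hbV, haH, hbH, hη]
  ring

end Piece

/-! ## §2 Coordinates: the V- and H-inputs of the next phase are affine along the piece -/

/-- Component `i` of `J ((c) e₀)` is `J i 0 · c`. [folklore] -/
theorem mulVec_smul_single_apply (J : Matrix (Fin 2) (Fin 2) ℝ) (c : ℝ) (i : Fin 2) :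
    (J *ᵥ (c • (Pi.single 0 1 : Fin 2 → ℝ))) i = J i 0 * c := by
  simp [Matrix.mulVec_smul, mul_comm]

/-- From the planar bound to the two coordinates: `|x′ − x − J₀₀c| ≤ E` and `|y′ − y − J₁₀c| ≤ E`. [folklore] -/
theorem abs_coord_sub_sub_le_of_norm_le {J : Matrix (Fin 2) (Fin 2) ℝ} {X X' : Fin 2 → ℝ} {c E : ℝ}
    (h : ‖(X' - X) - J *ᵥ (c • (Pi.single 0 1 : Fin 2 → ℝ))‖ ≤ E) (i : Fin 2) :
    |X' i - X i - J i 0 * c| ≤ E := by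
  have h1 := (norm_le_pi_norm ((X' - X) - J *ᵥ (c • (Pi.single 0 1 : Fin 2 → ℝ))) i).trans h
  rwa [Pi.sub_apply, Pi.sub_apply, mulVec_smul_single_apply, Real.norm_eq_abs] at h1

/-- **The H-input is affine where the V-input stays in one component.**  If along `[a, b]` the coordinates `x s, y s` satisfy
`|x s′ − x s − J₀₀(s′−s)| ≤ E`, `|y s′ − y s − J₁₀(s′−s)| ≤ E` and `x s` stays in the rank-`p` flat component of `U` (slope `σ_p` up to `η`),
then `cH s = y s − γU(x s)` is affine with slope `J₁₀ − γσ_pJ₀₀` up to `(1+γ)E + γη(|J₀₀|(b − a) + E)` (`γ ≥ 0`, `η ≥ 0`).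
[cite: ElgindiLissMattingly2025, §1.2.2] -/
theorem abs_cH_affine {U : ℝ → ℝ} {γ σ η aF bF : ℝ} (hγ : 0 ≤ γ) (hη : 0 ≤ η)
    (hU : ∀ x ∈ Icc aF bF, ∀ x' ∈ Icc aF bF, |U x - U x' - σ * (x - x')| ≤ η * |x - x'|) (hσ : σ = 1 ∨ σ = -1)
    (J : Matrix (Fin 2) (Fin 2) ℝ) {x y : ℝ → ℝ} {a b E : ℝ}
    (hx : ∀ s ∈ Icc a b, ∀ s' ∈ Icc a b, |x s' - x s - J 0 0 * (s' - s)| ≤ E)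
    (hy : ∀ s ∈ Icc a b, ∀ s' ∈ Icc a b, |y s' - y s - J 1 0 * (s' - s)| ≤ E)
    (hmem : ∀ s ∈ Icc a b, x s ∈ Icc aF bF) {s s' : ℝ} (hs : s ∈ Icc a b) (hs' : s' ∈ Icc a b) :
    |(y s' - γ * U (x s')) - (y s - γ * U (x s)) - (J 1 0 - γ * σ * J 0 0) * (s' - s)| ≤
      (1 + γ) * E + γ * η * (|J 0 0| * (b - a) + E) := by
  have h1 := hy s hs s' hs'
  have h2 := hx s hs s' hs'
  have h3 := hU (x s') (hmem s' hs') (x s) (hmem s hs)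
  have hσ1 : |σ| = 1 := by rcases hσ with rfl | rfl <;> norm_num
  have hss : |s' - s| ≤ b - a := by
    rw [abs_le]; constructor <;> linarith [hs.1, hs.2, hs'.1, hs'.2]
  have hdx : |x s' - x s| ≤ |J 0 0| * (b - a) + E := by
    have : |x s' - x s| ≤ |J 0 0 * (s' - s)| + |x s' - x s - J 0 0 * (s' - s)| := by
      have := abs_add_le (J 0 0 * (s' - s)) (x s' - x s - J 0 0 * (s' - s))
      rwa [add_sub_cancel] at this
    rw [abs_mul] at this
    nlinarith [abs_nonneg (J 0 0), mul_le_mul_of_nonneg_left hss (abs_nonneg (J 0 0))]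
  have e : (y s' - γ * U (x s')) - (y s - γ * U (x s)) - (J 1 0 - γ * σ * J 0 0) * (s' - s) =
      (y s' - y s - J 1 0 * (s' - s)) - γ * (U (x s') - U (x s) - σ * (x s' - x s)) -
        γ * σ * (x s' - x s - J 0 0 * (s' - s)) := by ring
  rw [e]
  have hA : |γ * (U (x s') - U (x s) - σ * (x s' - x s))| ≤ γ * η * (|J 0 0| * (b - a) + E) := by
    rw [abs_mul, abs_of_nonneg hγ, mul_assoc]
    exact mul_le_mul_of_nonneg_left (h3.trans (mul_le_mul_of_nonneg_left hdx hη)) hγ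
  have hB : |γ * σ * (x s' - x s - J 0 0 * (s' - s))| ≤ γ * E := by
    rw [abs_mul, abs_mul, abs_of_nonneg hγ, hσ1, mul_one]
    exact mul_le_mul_of_nonneg_left h2 hγ
  calc |(y s' - y s - J 1 0 * (s' - s)) - γ * (U (x s') - U (x s) - σ * (x s' - x s)) -
        γ * σ * (x s' - x s - J 0 0 * (s' - s))|
      ≤ |(y s' - y s - J 1 0 * (s' - s)) - γ * (U (x s') - U (x s) - σ * (x s' - x s))| +
        |γ * σ * (x s' - x s - J 0 0 * (s' - s))| := abs_sub _ _
    _ ≤ (|y s' - y s - J 1 0 * (s' - s)| + |γ * (U (x s') - U (x s) - σ * (x s' - x s))|) +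
        |γ * σ * (x s' - x s - J 0 0 * (s' - s))| := by gcongr; exact abs_sub _ _
    _ ≤ (E + γ * η * (|J 0 0| * (b - a) + E)) + γ * E := by gcongr
    _ = (1 + γ) * E + γ * η * (|J 0 0| * (b - a) + E) := by ring

/-! ## §3 The slopes of a piece -/

/-- **Slopes of a piece.**  For a sign list `L` and `γ² ≥ 8`, `γ > 0`: the V-slope `λ_V = (itinJac γ L)₀₀` has `|λ_V| ≥ (γ²−3)^{|L|}`
(so `λ_V ≠ 0`), and every H-slope `λ_H(p) = (itinJac γ L)₁₀ − γσ_p(itinJac γ L)₀₀` satisfies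
`(γ − 2/γ)|λ_V| ≤ |λ_H(p)| ≤ (γ + 2/γ)|λ_V|` (so `λ_H(p) ≠ 0`). [cite: ElgindiLissMattingly2025, §3.1 Lemma 3.1] -/
theorem slopes_piece {γ : ℝ} (hγ : 0 < γ) (h8 : 8 ≤ γ ^ 2) {L : List (ℝ × ℝ)} (hL : IsSignList L) :
    (γ ^ 2 - 3) ^ L.length ≤ |itinJac γ L 0 0| ∧ itinJac γ L 0 0 ≠ 0 ∧
    (∀ p : ℤ, itinJac γ L 1 0 - γ * (1 - 2 * ((p % 2 : ℤ) : ℝ)) * itinJac γ L 0 0 ≠ 0) ∧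
    (∀ p : ℤ, (γ - 2 / γ) * |itinJac γ L 0 0| ≤ |itinJac γ L 1 0 - γ * (1 - 2 * ((p % 2 : ℤ) : ℝ)) * itinJac γ L 0 0|) ∧
    (∀ p : ℤ, |itinJac γ L 1 0 - γ * (1 - 2 * ((p % 2 : ℤ) : ℝ)) * itinJac γ L 0 0| ≤ (γ + 2 / γ) * |itinJac γ L 0 0|) := by
  obtain ⟨hcol, hgrow⟩ := col_cone_itinJac hγ h8 hL
  have hg3 : 0 < (γ ^ 2 - 3) ^ L.length := pow_pos (by linarith) _
  have hne : itinJac γ L 0 0 ≠ 0 := fun h => by rw [h, abs_zero] at hgrow; linarith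
  have hpos : 0 < |itinJac γ L 0 0| := abs_pos.mpr hne
  have hγ2 : 0 < γ - 2 / γ := by
    rw [sub_pos, div_lt_iff₀ hγ]; nlinarith
  have hlow : ∀ p : ℤ, (γ - 2 / γ) * |itinJac γ L 0 0| ≤
      |itinJac γ L 1 0 - γ * (1 - 2 * ((p % 2 : ℤ) : ℝ)) * itinJac γ L 0 0| :=
    fun p => abs_sub_mul_itinJac_ge hγ h8 hL (rankSign_eq_or p)
  refine ⟨hgrow, hne, fun p h => ?_, hlow, fun p => ?_⟩
  · have := hlow p
    rw [h, abs_zero] at this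
    nlinarith
  · have hσ1 : |(1 - 2 * ((p % 2 : ℤ) : ℝ))| = 1 := by rcases rankSign_eq_or p with h | h <;> rw [h] <;> norm_num
    have h10 : |itinJac γ L 1 0| ≤ 2 / γ * |itinJac γ L 0 0| := by
      rw [div_mul_eq_mul_div, le_div_iff₀ hγ, mul_comm]; exact hcol
    calc |itinJac γ L 1 0 - γ * (1 - 2 * ((p % 2 : ℤ) : ℝ)) * itinJac γ L 0 0|
        ≤ |itinJac γ L 1 0| + |γ * (1 - 2 * ((p % 2 : ℤ) : ℝ)) * itinJac γ L 0 0| := abs_sub _ _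
      _ = |itinJac γ L 1 0| + γ * |itinJac γ L 0 0| := by rw [abs_mul, abs_mul, hσ1, abs_of_pos hγ, mul_one]
      _ ≤ 2 / γ * |itinJac γ L 0 0| + γ * |itinJac γ L 0 0| := by gcongr
      _ = (γ + 2 / γ) * |itinJac γ L 0 0| := by ring

/-- The itinerary of a piece is a sign list of length `ℓ`. [folklore] -/
theorem isSignList_pieceItin (pV pH : ℕ → ℤ) (j₀ ℓ : ℕ) :
    IsSignList ((List.range ℓ).map fun i =>
      (-(1 - 2 * ((pH (j₀ + i) % 2 : ℤ) : ℝ)), -(1 - 2 * ((pV (j₀ + i) % 2 : ℤ) : ℝ)))) ∧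
    ((List.range ℓ).map fun i =>
      (-(1 - 2 * ((pH (j₀ + i) % 2 : ℤ) : ℝ)), -(1 - 2 * ((pV (j₀ + i) % 2 : ℤ) : ℝ)))).length = ℓ :=
  isSignList_itinerary (fun i => 1 - 2 * ((pH (j₀ + i) % 2 : ℤ) : ℝ)) (fun i => 1 - 2 * ((pV (j₀ + i) % 2 : ℤ) : ℝ))
    (fun _ => rankSign_eq_or _) (fun _ => rankSign_eq_or _) ℓ

/-! ## §4 Assembly: the two hypotheses of `phase_cut` on a good piece -/

section Assembly

variable (P : CascadeParams)

/-- **The hypotheses of `phase_cut` on a good piece.**  With the data of `norm_traj_sub_sub_itinJac_le` at level `j + 1` (`j < n`,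
the phase to be cut is `j`), `cV s = (z_s (j+1))₀`, `cH s = (z_s (j+1))₁ − γU_j((z_s (j+1))₀)`, `J = itinJac γ L`, `Err` the planar error
and `u ≤ v`: (hcV) `|cV s′ − cV s − J₀₀(s′−s)| ≤ Err` on `[u, v]`; (hcH) on every `[a, b] ⊆ [u, v]` along which `cV` stays in the rank-`p`
component of stage `j`, `|cH s′ − cH s − (J₁₀ − γσ_pJ₀₀)(s′−s)| ≤ (1+γ)Err + γη(|J₀₀|(v − u) + Err)`.
[cite: ElgindiLissMattingly2025, §1.2.2, §3.1] -/
theorem piece_affine (hγ : 1 ≤ P.γ) (hδ₀ : 0 < P.δ₀) (hd : 0 < P.d) (hN₀ : 1 ≤ P.N₀) (hρ : 1 ≤ P.ρN)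
    {M₂ : ℝ} (hM : 1 ≤ M₂) (hMδ : ∀ j, M₂ * P.δ j < Real.pi / 2) {n j : ℕ} (hj : j < n) (Y : EuclideanSpace ℝ (Fin 2))
    (z : ℝ → ℕ → EuclideanSpace ℝ (Fin 2)) (hzn : ∀ s, z s n = Y + s • EuclideanSpace.single 0 1)
    (hz : ∀ s, ∀ j < n, z s j = shearMapLift 0 1 (amp ⟨P.U j, P.U_periodic j, P.contDiff_U (P.δ_pos hδ₀ hd j)⟩ P.γ)
      (shearMapLift 1 0 (amp ⟨P.U j, P.U_periodic j, P.contDiff_U (P.δ_pos hδ₀ hd j)⟩ P.γ) (z s (j + 1))))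
    {u v : ℝ} (pV pH : ℕ → ℤ)
    (hgood : ∀ s ∈ Icc u v, ∀ j', j + 1 ≤ j' → j' < n →
      (z s (j' + 1)) 0 ∈ Icc (((pV j' : ℝ) / 2 - 1 / 4) / P.N j' + M₂ * P.δ j' / (2 * Real.pi * P.N j'))
        (((pV j' : ℝ) / 2 + 1 / 4) / P.N j' - M₂ * P.δ j' / (2 * Real.pi * P.N j')) ∧
      (z s (j' + 1)) 1 - P.γ * P.U j' ((z s (j' + 1)) 0) ∈
        Icc (((pH j' : ℝ) / 2 - 1 / 4) / P.N j' + M₂ * P.δ j' / (2 * Real.pi * P.N j'))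
        (((pH j' : ℝ) / 2 + 1 / 4) / P.N j' - M₂ * P.δ j' / (2 * Real.pi * P.N j')))
    {J : Matrix (Fin 2) (Fin 2) ℝ}
    (hJ : J = itinJac P.γ ((List.range (n - (j + 1))).map fun i =>
      (-(1 - 2 * ((pH (j + 1 + i) % 2 : ℤ) : ℝ)), -(1 - 2 * ((pV (j + 1 + i) % 2 : ℤ) : ℝ)))))
    {Err : ℝ}
    (hErr : Err = ∑ i ∈ Finset.range (n - (j + 1)), (1 + P.γ + P.γ ^ 2) ^ i *
        ((P.γ ^ 2 * (1 / (2 * P.N (j + 1 + i)) - M₂ * P.δ (j + 1 + i) / (Real.pi * P.N (j + 1 + i))) +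
          P.γ * (1 / (2 * P.N (j + 1 + i)) - M₂ * P.δ (j + 1 + i) / (Real.pi * P.N (j + 1 + i)))) *
          (2 * Real.exp (-(M₂ ^ 2 / 2))))) :
    (∀ s ∈ Icc u v, ∀ s' ∈ Icc u v, |(z s' (j + 1)) 0 - (z s (j + 1)) 0 - J 0 0 * (s' - s)| ≤ Err) ∧
    (∀ (p : ℤ) (a b : ℝ), Icc a b ⊆ Icc u v →
      (∀ s ∈ Icc a b, (z s (j + 1)) 0 ∈
        Icc (((p : ℝ) / 2 - 1 / 4) / P.N j + M₂ * P.δ j / (2 * Real.pi * P.N j))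
          (((p : ℝ) / 2 + 1 / 4) / P.N j - M₂ * P.δ j / (2 * Real.pi * P.N j))) →
      ∀ s ∈ Icc a b, ∀ s' ∈ Icc a b,
        |((z s' (j + 1)) 1 - P.γ * P.U j ((z s' (j + 1)) 0)) - ((z s (j + 1)) 1 - P.γ * P.U j ((z s (j + 1)) 0)) -
          (J 1 0 - P.γ * (1 - 2 * ((p % 2 : ℤ) : ℝ)) * J 0 0) * (s' - s)| ≤
        (1 + P.γ) * Err + P.γ * (2 * Real.exp (-(M₂ ^ 2 / 2))) * (|J 0 0| * (v - u) + Err)) := by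
  have hplanar : ∀ s ∈ Icc u v, ∀ s' ∈ Icc u v,
      ‖(WithLp.ofLp (z s' (j + 1)) - WithLp.ofLp (z s (j + 1))) - J *ᵥ ((s' - s) • (Pi.single 0 1 : Fin 2 → ℝ))‖ ≤ Err := by
    intro s hs s' hs'
    rw [hJ, hErr]
    exact norm_traj_sub_sub_itinJac_le P hγ hδ₀ hd hN₀ hρ hM hMδ (by omega) Y z hzn hz pV pH hgood hs hs'
  have hcoord : ∀ s ∈ Icc u v, ∀ s' ∈ Icc u v, ∀ i : Fin 2,
      |(z s' (j + 1)) i - (z s (j + 1)) i - J i 0 * (s' - s)| ≤ Err :=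
    fun s hs s' hs' i => abs_coord_sub_sub_le_of_norm_le (hplanar s hs s' hs') i
  refine ⟨fun s hs s' hs' => hcoord s hs s' hs' 0, fun p a b hab hmem s hs s' hs' => ?_⟩
  have hγ0 : 0 ≤ P.γ := by linarith
  have hη0 : (0 : ℝ) ≤ 2 * Real.exp (-(M₂ ^ 2 / 2)) := by positivity
  rcases le_or_gt a b with hab' | hab'
  · have hba : b - a ≤ v - u := by
      have ha := hab (left_mem_Icc.mpr hab')
      have hb := hab (right_mem_Icc.mpr hab')
      linarith [ha.1, hb.2]
    have h := abs_cH_affine (U := P.U j) (γ := P.γ) hγ0 hη0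
      (fun x hx x' hx' => abs_U_sub_U_sub_rankSign_le P hδ₀ hd hN₀ hρ hM (hMδ j) p hx hx') (rankSign_eq_or p) J
      (x := fun t => (z t (j + 1)) 0) (y := fun t => (z t (j + 1)) 1)
      (fun t ht t' ht' => hcoord t (hab ht) t' (hab ht') 0) (fun t ht t' ht' => hcoord t (hab ht) t' (hab ht') 1) hmem hs hs'
    refine h.trans ?_
    have hE : 0 ≤ Err := (abs_nonneg _).trans (hcoord s (hab hs) s (hab hs) 0)
    gcongr
  · exact absurd (hs.1.trans hs.2) (not_le.mpr hab')

end Assembly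

end Summit.AnomalousDissipation.AnomalousDissipation.Theorems.SawtoothPulseCascade.K1Start
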